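import Literature.Probability.Percolation.LocallyMonotoneFKG
import Literature.Probability.Percolation.BernoulliPercolation
import HarnessLib

/-!
# Nolin's generalised FKG inequality for Bernoulli BOND percolation

Topic `Literature/Probability/Percolation`; proof-only file. `LocallyMonotoneFKG.lean` proves
Nolin's generalised FKG inequality for locally monotone events (P. Nolin, *Near-critical
percolation in two dimensions*, EJP 13 (2008), §4.3, Lemma 13 = Lemma 12 of arXiv:0711.4948:
"Consider `A⁺, Ã⁺` two increasing events, and `A⁻, Ã⁻` two decreasing events. Assume that there
exist three disjoint finite sets of vertices `𝒜`, `𝒜⁺` and `𝒜⁻` such that `A⁺, A⁻, Ã⁺` and `Ã⁻`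
depend only on the sites in, respectively, `𝒜 ∪ 𝒜⁺`, `𝒜 ∪ 𝒜⁻`, `𝒜⁺` and `𝒜⁻`. Then we have
`P(Ã⁺ ∩ Ã⁻ | A⁺ ∩ A⁻) ≥ P(Ã⁺) P(Ã⁻)` for any product measure `P`") for arbitrary product
probability measures and specialises it to SITE percolation only. This file records the
specialisation to Bernoulli bond percolation `P_p = bondPercolation G p` on an arbitrary graph
(events of bond configurations determined by finite sets of pairs, `DeterminedBy`), transported
from `infinitePi_locallyMonotone_fkg` along `q ↦ {e | q e}` exactly as
`sitePercolation_locallyMonotone_fkg` — the gluing tool of every arm-extension / arm-separation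
argument with arms of both colours on `ℤ²` (Nolin 2008, Prop. 12; Kesten 1987), in particular of
the separation input of `Literature.Probability.Percolation.Garban2011_fourArm_multiscale`
(`FourArmGarban.lean`, `FourArmGarbanConditional.lean`, field `sep`). No definition, no named fact.

## References

* P. Nolin, Electron. J. Probab. 13 (2008), §4.3, Lemma 13 (arXiv 0711.4948: Lemma 12) [Nolin2008].
* G. Grimmett, *Percolation*, 2nd ed. (1999), Thm (2.4) [GrimmettPercolation1999].

Tree: `infinitePi_locallyMonotone_fkg` (`LocallyMonotoneFKG.lean`), `bondPercolation`
(`Percolation.lean`), `DeterminedBy`, `DeterminedBy.measurableSet_of_finset`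
(`PercolationEvents.lean`). Mathlib: `ProbabilityTheory.setBernoulli_apply'`, `measurable_setOf`.
-/

noncomputable section

namespace Literature.Probability.Percolation

open _root_.MeasureTheory _root_.ProbabilityTheory Set

variable {V : Type*}

/-- **Nolin's generalised FKG inequality for Bernoulli bond percolation** (Nolin 2008, EJP
Lemma 13 = arXiv Lemma 12, for the product measure `P_p` on bond configurations): for three
pairwise disjoint finite sets of pairs `S, P, M`, an increasing event `A⁺` and a decreasing event
`A⁻` determined by the pairs of `S ∪ P`, resp. `S ∪ M`, and an increasing event `Ã⁺` and a
decreasing event `Ã⁻` determined by the pairs of `P`, resp. `M`,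
`P_p(A⁺ ∩ A⁻) P_p(Ã⁺) P_p(Ã⁻) ≤ P_p((A⁺ ∩ A⁻) ∩ (Ã⁺ ∩ Ã⁻))`. [cite: Nolin2008, §4.3, Lemma 13 (arXiv 0711.4948: Lemma 12)] -/
theorem bondPercolation_locallyMonotone_fkg (G : SimpleGraph V) (p : unitInterval)
    {S P M : Finset (Sym2 V)} (hSP : Disjoint S P) (hSM : Disjoint S M) (hPM : Disjoint P M)
    {Ap Am Bp Bm : Set (BondConfig V)}
    (hAp : IsUpperSet Ap) (hAm : IsLowerSet Am) (hBp : IsUpperSet Bp) (hBm : IsLowerSet Bm)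
    (dAp : DeterminedBy Ap (↑S ∪ ↑P)) (dAm : DeterminedBy Am (↑S ∪ ↑M))
    (dBp : DeterminedBy Bp ↑P) (dBm : DeterminedBy Bm ↑M) :
    (bondPercolation G p).real (Ap ∩ Am) *
        ((bondPercolation G p).real Bp * (bondPercolation G p).real Bm) ≤
      (bondPercolation G p).real (Ap ∩ Am ∩ (Bp ∩ Bm)) := by
  classical
  -- transport to the product measure on `Sym2 V → Prop` along `χ ↦ {e | χ e}`
  set μ : Sym2 V → Measure Prop := fun i =>
    unitInterval.toNNReal p • Measure.dirac (i ∈ G.edgeSet) +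
      unitInterval.toNNReal (unitInterval.symm p) • Measure.dirac False with hμ
  set mk : (Sym2 V → Prop) → BondConfig V := fun χ => {e | χ e} with hmk
  have hmk_meas : Measurable mk := measurable_setOf
  have hmono : Monotone mk := fun χ χ' h e (he : χ e) => h e he
  have hreal : ∀ A : Set (BondConfig V),
      (bondPercolation G p).real A = (Measure.infinitePi μ).real (mk ⁻¹' A) := fun A => by
    simp only [measureReal_def, bondPercolation, setBernoulli_apply', hmk, hμ]
  have hup : ∀ {A : Set (BondConfig V)}, IsUpperSet A → IsUpperSet (mk ⁻¹' A) :=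
    fun hA χ χ' h hχ => hA (hmono h) hχ
  have hlow : ∀ {A : Set (BondConfig V)}, IsLowerSet A → IsLowerSet (mk ⁻¹' A) :=
    fun hA χ χ' h hχ => hA (hmono h) hχ
  have hdep : ∀ {A : Set (BondConfig V)} {F : Set (Sym2 V)}, DeterminedBy A F →
      DependsOn (· ∈ mk ⁻¹' A) F := fun hA χ χ' h => hA h
  have hSP' : DeterminedBy Ap ↑(S ∪ P) := by simpa only [Finset.coe_union] using dAp
  have hSM' : DeterminedBy Am ↑(S ∪ M) := by simpa only [Finset.coe_union] using dAm
  have hmeas : ∀ {A : Set (BondConfig V)} {F : Finset (Sym2 V)}, DeterminedBy A ↑F →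
      MeasurableSet (mk ⁻¹' A) := fun hA => hmk_meas hA.measurableSet_of_finset
  rw [hreal, hreal, hreal, hreal, Set.preimage_inter, Set.preimage_inter, Set.preimage_inter]
  exact infinitePi_locallyMonotone_fkg μ hSP hSM hPM (hup hAp) (hlow hAm) (hup hBp) (hlow hBm)
    (hmeas hSP') (hmeas hSM') (hmeas dBp) (hmeas dBm) (hdep dAp) (hdep dAm) (hdep dBp) (hdep dBm)

/-- **Conditional form**: if moreover `P_p(A⁺ ∩ A⁻) > 0`, then
`P_p(Ã⁺) P_p(Ã⁻) ≤ P_p(Ã⁺ ∩ Ã⁻ | A⁺ ∩ A⁻)` (elementary conditional probability), as printed by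
Nolin: "once well-separated, the arms can easily be extended". [cite: Nolin2008, §4.3, Lemma 13 (arXiv 0711.4948: Lemma 12)] -/
theorem bondPercolation_locallyMonotone_fkg_cond (G : SimpleGraph V) (p : unitInterval)
    {S P M : Finset (Sym2 V)} (hSP : Disjoint S P) (hSM : Disjoint S M) (hPM : Disjoint P M)
    {Ap Am Bp Bm : Set (BondConfig V)}
    (hAp : IsUpperSet Ap) (hAm : IsLowerSet Am) (hBp : IsUpperSet Bp) (hBm : IsLowerSet Bm)
    (dAp : DeterminedBy Ap (↑S ∪ ↑P)) (dAm : DeterminedBy Am (↑S ∪ ↑M))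
    (dBp : DeterminedBy Bp ↑P) (dBm : DeterminedBy Bm ↑M)
    (h0 : 0 < (bondPercolation G p).real (Ap ∩ Am)) :
    (bondPercolation G p).real Bp * (bondPercolation G p).real Bm ≤
      (bondPercolation G p).real (Ap ∩ Am ∩ (Bp ∩ Bm)) / (bondPercolation G p).real (Ap ∩ Am) := by
  rw [le_div_iff₀ h0]
  have h := bondPercolation_locallyMonotone_fkg G p hSP hSM hPM hAp hAm hBp hBm dAp dAm dBp dBm
  nlinarith [h]

end Literature.Probability.Percolation
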